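import Literature.LinearAlgebra.Matrix.PolynomialMatrixRankLoci
import HarnessLib

/-!
# Seed checker v22 (c5c8-1 g21): ONE TWIST DECIDES — C7 at the lci door as a twist-free predicate on (design, presentation)

Cell `pub-hsemireg`, explicit unit `hsemireg-c5c8-1` (MINT A5: type C5–C8 as predicates on (design json, presentation) «so a seed
checker exists before a candidate does»), generation g21. Companion to v21 `SeedCheckerBlochAdjugate.lean` (g20), whose pen theorem
(L5⁺) and named law `BlochAdjugateLaw` turn **C7 = `IsBlochSemiregular i (2·4) 4`** of the zero locus `Z(s)` of a regular section `s`
of `𝓕 = 𝓔(tΘ)` (in the Koszul window `t ≥ t₀`) into **injectivity of the Bloch pencil**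
`Π_t = f₃ + v₁(t)·f₂ + v₂(t)·f₁ + v₃(t)·f₀` on the `t`-INDEPENDENT space `Ext²(𝓔, 𝓔)` (`f_j = h^{3−j} ∪ σ̃_j^{𝓔}`,
`v₁ = γ₁ + t`, `v₂ = γ₂ + γ₁t + t²`, `v₃ = γ₃ + γ₂t + γ₁t² + t³`, `γ_k` = the design's Chern numbers). g20 left the remark
«ONE TWIST DECIDES GENERICALLY» (memo g20 §2 (4)(iv)) untyped. This file TYPES AND PROVES it, as pure linear algebra, by citing
the tree's rank-loci theorems for one-parameter polynomial matrix families
(`Literature.LinearAlgebra.Matrix.setOf_rank_map_eval_lt_finite`, `…ncard_setOf_rank_map_eval_lt_le`,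
`…rank_map_eval_le_of_forall_mem` — [Harris1992, Lecture 9], folklore lower semicontinuity of rank), and draws the checker-shaped
consequences. It imports NO satellite (v4–v21): only `Literature` and Mathlib, so it is checkable today; the link to v21 is
definitional (`polyFamily_blochCoeff` below is v21's `BlochPencil.pencilₗ f γ₁ γ₂ γ₃ t` unfolded — `rfl` once v21 is built).

## Contents (everything PROVED; no `sorry`, no axiom, no `instance`, no `notation`)

§22.1 `TwistRay.polyFamily G t = Σ_{k ≤ d} t^k • G k` — a polynomial one-parameter family of `K`-linear maps `V → W`
(`V`, `W` finite-dimensional over a field `K`), its coordinate matrix `polyMatrix G ∈ Mat(K[X])` (entries of degree `≤ d`,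
`polyMatrix_map_eval : (polyMatrix G).map (eval t) = toMatrix (polyFamily G t)`), and the GENERIC-PARAMETER DICHOTOMY:
* `setOf_not_injective_finite` — injective at ONE parameter ⟹ injective at all but finitely many;
* `ncard_setOf_not_injective_le` — … with at most `d · dim V` exceptions;
* `not_injective_of_card_lt` — DEATH CERTIFICATE: non-injective at MORE than `d · dim V` parameters ⟹ non-injective at EVERY parameter;
* `eventually_cofinite_injective_or_forall_not` — the dichotomy (cofinitely injective, or never);
* `setOf_lt_finrank_ker_finite` — the kernel dimension (the semiregularity DEFECT under the law) is generically minimal: its value at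
  one parameter bounds it at all but finitely many;
* `RayGenericallyInjective d G := ∃ t, Injective Π_t` — THE `t`-FREE PREDICATE, with `rayGenericallyInjective_iff_eventually_cofinite`
  and the finite-evaluation form `rayGenericallyInjective_iff_forall_finset` (⟺ every set of `> d · dim V` parameters contains an injective one).
§22.2 `TwistRay.blochCoeff f γ₁ γ₂ γ₃` — the four COEFFICIENTS `G₀ = f₃ + γ₁f₂ + γ₂f₁ + γ₃f₀` (the untwisted polarised `D_ξ c₄`),
`G₁ = f₂ + γ₁f₁ + γ₂f₀`, `G₂ = f₁ + γ₁f₀`, `G₃ = f₀` (`= h³ ∪ Tr`, the TRACE: the `t → ∞` limit of the ray) of the Bloch pencil as a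
cubic polynomial family (`polyFamily_blochCoeff`); the Bloch specialisations: `≤ 3 · ext²(𝓔,𝓔) ≤ 3 · 3136 = 9408` exceptional
twists (`blochRay_ncard_exceptional_le[_of_budget]`, `blochRay_dead_of_failures[_of_budget]`, `nine_thousand_four_hundred_eight`); and
**`LciDoorGeneric f γ₁ γ₂ γ₃ := RayGenericallyInjective 3 (blochCoeff f γ₁ γ₂ γ₃)`** — the seed checker's C7-lci clause on
(design = `γ`, presentation = `f`), with `lciDoorGeneric_of_untwisted_injective` (the design's OWN polarised `D_ξ c₄` injective suffices)
and `not_lciDoorGeneric_of_finrank_lt` (the budget is necessary).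
§22.3 CHECKER-SHAPED CONSEQUENCES under an abstract dictionary `∀ t ∈ S, (C7At t ↔ Injective (Π t))` (the shape of v21's
`BlochAdjugateLaw` + `blochAdjugate_eq_pencil_of_realisedBy` on the window `S`; `C7At t` = «C7 at the lci door for the twisted design
`D(t)` with the given presentation»): `cofinite_good_of_injective_once` (a certificate at ANY parameter `t₁ : K` — inside the window or
not, e.g. the UNTWISTED `t = 0` — makes C7 hold at all but `≤ d·dim V` twists of the window), `forall_not_good_of_failures` (the death
certificate), **`rayGenericallyInjective_iff_exists_good` ∕ `…_iff_cofinite_good`** (infinite window: the `t`-free predicate ⟺ C7 at SOME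
window twist ⟺ C7 at all but finitely many window twists; Bloch forms `lciDoorGeneric_iff_exists_good` ∕ `…_iff_cofinite_good`,
`ncard_bad_le_of_lciDoorGeneric`), and the integer forms `eventually_atTop_good_of_injective_once` (`∀ᶠ t in atTop, C7At t` — v17's
`EventuallySemiregularZeroLoci` shape — from ONE injective twist) and `ncard_bad_integer_twists_le`.
§22.4 FLAGS as theorems: lci-C7 is NOT implied by the sheaf door's joint injectivity of `f₀, …, f₃` (`jointly_injective_not_suffices`:
an explicit `ℚ²`-example, jointly injective, Bloch ray injective at no twist for no Chern data), and not vacuous either way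
(`rayGenericallyInjective_example`, `not_rayGenericallyInjective_example`).

## Honest status

Nothing here is proved toward HC ∕ HC_CM ∕ HC_AV ∕ №4 ∕ 26512 ∕ 18881 ∕ H2; this is a typed file + evidence, not a rung. The dictionary
between C7 and pencil injectivity is v21's HYPOTHESIS `BlochAdjugateLaw` (pen theorem (L5⁺), BF2003 Prop. 8.2 + Lemma 8.4 + Koszul); here it
enters only as the abstract hypothesis `hdict`. What is new is small and exact: the lci-door C7 clause of the seed checker becomes the
`t`-FREE predicate «the Bloch ray of (design, presentation) is generically injective», decidable by ONE rank computation at ANY twist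
(success) or by `3·ext² + 1 ≤ 9409` rank computations (death), with kernel-checked bounds.

[cite: Harris1992, Lecture 9] [cite: BuchweitzFlenner2003, Prop. 8.2, Lemma 8.4] [cite: Bloch1972Semiregularity, §4–§6 (cite-only)]
-/

set_option linter.dupNamespace false

noncomputable section

namespace Summit.HodgeConjecture.HodgeConjecture.Cruxes.BlochSeedDiscOne.SeedChecker

section VTwentyTwo

namespace TwistRay

open _root_.Polynomial _root_.Matrix

variable {K : Type*} [Field K] {V W : Type*} [AddCommGroup V] [Module K V] [AddCommGroup W] [Module K W]

/-! ### §22.1 Polynomial one-parameter families of linear maps: the generic-parameter dichotomy -/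

/-- **a polynomial one-parameter family ("ray") of linear maps** with coefficients `G 0, …, G d`:
`Π_t = Σ_{k=0}^{d} t^k • G k`. A DEFINITION (pure algebra). -/
def polyFamily (d : ℕ) (G : ℕ → (V →ₗ[K] W)) (t : K) : V →ₗ[K] W :=
  ∑ k ∈ Finset.range (d + 1), t ^ k • G k

theorem polyFamily_apply (d : ℕ) (G : ℕ → (V →ₗ[K] W)) (t : K) (x : V) :
    polyFamily d G t x = ∑ k ∈ Finset.range (d + 1), t ^ k • G k x := by
  simp [polyFamily, LinearMap.sum_apply, LinearMap.smul_apply]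

/-- **THE `t`-FREE PREDICATE**: a polynomial ray of linear maps is GENERICALLY INJECTIVE if it is injective at some parameter
(equivalently, over an infinite field: at all but finitely many — `rayGenericallyInjective_iff_eventually_cofinite`; equivalently: in
every set of more than `d · dim V` parameters some member is injective — `rayGenericallyInjective_iff_forall_finset`, the form a
finite evaluation protocol decides). For the Bloch ray (§22.2) this is the seed checker's C7-at-the-lci-door clause read on
(design, presentation), no twist and no section chosen. A DEFINITION. -/
def RayGenericallyInjective (d : ℕ) (G : ℕ → (V →ₗ[K] W)) : Prop :=
  ∃ t : K, Function.Injective (polyFamily d G t)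

/-- negation, the DEAD form: not generically injective ⟺ injective at NO parameter. [logic] -/
theorem not_rayGenericallyInjective_iff (d : ℕ) (G : ℕ → (V →ₗ[K] W)) :
    ¬ RayGenericallyInjective d G ↔ ∀ t : K, ¬ Function.Injective (polyFamily d G t) := by
  simp [RayGenericallyInjective]

section Coordinates

variable [FiniteDimensional K V] [FiniteDimensional K W]

/-- the COORDINATE MATRIX of the family in the bases `Module.finBasis`: a `dim W × dim V` matrix over `K[X]` with
`(i,j)` entry `Σ_k (G k)_{ij} X^k`. -/
def polyMatrix (d : ℕ) (G : ℕ → (V →ₗ[K] W)) :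
    Matrix (Fin (Module.finrank K W)) (Fin (Module.finrank K V)) K[X] :=
  fun i j => ∑ k ∈ Finset.range (d + 1),
    C (LinearMap.toMatrix (Module.finBasis K V) (Module.finBasis K W) (G k) i j) * X ^ k

/-- every entry of the coordinate matrix has degree `≤ d`. -/
theorem natDegree_polyMatrix_le (d : ℕ) (G : ℕ → (V →ₗ[K] W)) (i : Fin (Module.finrank K W))
    (j : Fin (Module.finrank K V)) : (polyMatrix d G i j).natDegree ≤ d := by
  unfold polyMatrix
  refine natDegree_sum_le_of_forall_le _ _ fun k hk => ?_
  exact (natDegree_C_mul_X_pow_le _ _).trans (by simpa [Finset.mem_range, Nat.lt_succ_iff] using hk)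

/-- **specialisation = coordinates of the specialised map**: `(polyMatrix G)(t) = toMatrix (Π_t)`. -/
theorem polyMatrix_map_eval (d : ℕ) (G : ℕ → (V →ₗ[K] W)) (t : K) :
    (polyMatrix d G).map (eval t) =
      LinearMap.toMatrix (Module.finBasis K V) (Module.finBasis K W) (polyFamily d G t) := by
  ext i j
  simp only [polyMatrix, polyFamily, Matrix.map_apply, eval_finsetSum, eval_mul, eval_C, eval_pow, eval_X, map_sum,
    map_smul, Matrix.sum_apply, Matrix.smul_apply, smul_eq_mul]
  exact Finset.sum_congr rfl fun k _ => mul_comm _ _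

/-- the rank of a coordinate matrix is the dimension of the range. [Mathlib `Matrix.rank_eq_finrank_range_toLin`] -/
theorem rank_toMatrix_eq_finrank_range (g : V →ₗ[K] W) :
    (LinearMap.toMatrix (Module.finBasis K V) (Module.finBasis K W) g).rank =
      Module.finrank K (LinearMap.range g) := by
  rw [Matrix.rank_eq_finrank_range_toLin _ (Module.finBasis K W) (Module.finBasis K V), Matrix.toLin_toMatrix]

omit [FiniteDimensional K W] in
/-- injectivity ⟺ full rank `dim V ≤ dim (range g)` (rank–nullity). -/
theorem injective_iff_finrank_le_finrank_range (g : V →ₗ[K] W) :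
    Function.Injective g ↔ Module.finrank K V ≤ Module.finrank K (LinearMap.range g) := by
  constructor
  · intro h
    exact (LinearMap.finrank_range_of_inj h).ge
  · intro h
    have hrn := g.finrank_range_add_finrank_ker
    have hker : Module.finrank K (LinearMap.ker g) = 0 := by omega
    rw [Submodule.finrank_eq_zero] at hker
    exact LinearMap.ker_eq_bot.1 hker

/-- the rank of the specialised coordinate matrix detects injectivity of `Π_t`. -/
theorem injective_polyFamily_iff_le_rank (d : ℕ) (G : ℕ → (V →ₗ[K] W)) (t : K) :
    Function.Injective (polyFamily d G t) ↔ Module.finrank K V ≤ ((polyMatrix d G).map (eval t)).rank := by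
  rw [polyMatrix_map_eval, rank_toMatrix_eq_finrank_range, injective_iff_finrank_le_finrank_range]

/-- **ONE PARAMETER DECIDES (finiteness).** If `Π_{t₀}` is injective for ONE parameter `t₀`, then `Π_t` is injective for all but
finitely many `t`. [folklore: lower semicontinuity of rank; cites `Literature.LinearAlgebra.Matrix.setOf_rank_map_eval_lt_finite`] -/
theorem setOf_not_injective_finite (d : ℕ) (G : ℕ → (V →ₗ[K] W)) {t₀ : K}
    (h₀ : Function.Injective (polyFamily d G t₀)) :
    {t : K | ¬ Function.Injective (polyFamily d G t)}.Finite := by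
  have h₀' := (injective_polyFamily_iff_le_rank d G t₀).1 h₀
  refine (Literature.LinearAlgebra.Matrix.setOf_rank_map_eval_lt_finite (polyMatrix d G) h₀').subset ?_
  intro t ht
  simp only [Set.mem_setOf_eq, injective_polyFamily_iff_le_rank, not_le] at ht ⊢
  exact ht

/-- **… with at most `d · dim V` exceptions.** [cites `Literature.LinearAlgebra.Matrix.ncard_setOf_rank_map_eval_lt_le`] -/
theorem ncard_setOf_not_injective_le (d : ℕ) (G : ℕ → (V →ₗ[K] W)) {t₀ : K}
    (h₀ : Function.Injective (polyFamily d G t₀)) :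
    {t : K | ¬ Function.Injective (polyFamily d G t)}.ncard ≤ Module.finrank K V * d := by
  classical
  have h₀' := (injective_polyFamily_iff_le_rank d G t₀).1 h₀
  have hset : {t : K | ¬ Function.Injective (polyFamily d G t)} =
      {t : K | ((polyMatrix d G).map (eval t)).rank < Module.finrank K V} := by
    ext t
    simp only [Set.mem_setOf_eq, injective_polyFamily_iff_le_rank, not_le]
  rw [hset]
  exact Literature.LinearAlgebra.Matrix.ncard_setOf_rank_map_eval_lt_le (polyMatrix d G)
    (natDegree_polyMatrix_le d G) h₀'

/-- **DEATH CERTIFICATE.** If `Π_t` fails to be injective at MORE than `d · dim V` distinct parameters, it is injective at NO parameter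
(every maximal minor, of degree `≤ d · dim V`, vanishes identically). [cites `Literature.LinearAlgebra.Matrix.rank_map_eval_le_of_forall_mem`] -/
theorem not_injective_of_card_lt (d : ℕ) (G : ℕ → (V →ₗ[K] W)) (T : Finset K)
    (hcard : Module.finrank K V * d < T.card) (hT : ∀ t ∈ T, ¬ Function.Injective (polyFamily d G t)) (t : K) :
    ¬ Function.Injective (polyFamily d G t) := by
  rcases Nat.eq_zero_or_pos (Module.finrank K V) with hV | hV
  · -- `V = 0`: every map is injective, so `T` must be empty — contradiction with `hcard`.
    exfalso
    have hne : T.Nonempty := Finset.card_pos.1 (lt_of_le_of_lt (Nat.zero_le _) hcard)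
    obtain ⟨t₁, ht₁⟩ := hne
    refine hT t₁ ht₁ ((injective_iff_finrank_le_finrank_range _).2 ?_)
    rw [hV]; exact Nat.zero_le _
  · intro hinj
    have hle : ∀ b : K, ((polyMatrix d G).map (eval b)).rank ≤ Module.finrank K V - 1 := by
      refine Literature.LinearAlgebra.Matrix.rank_map_eval_le_of_forall_mem (polyMatrix d G)
        (natDegree_polyMatrix_le d G) T ?_ ?_
      · have : Module.finrank K V - 1 + 1 = Module.finrank K V := Nat.sub_add_cancel hV
        rw [this]; exact hcard
      · intro b hb
        have := hT b hb
        rw [injective_polyFamily_iff_le_rank, not_le] at this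
        omega
    have h1 := (injective_polyFamily_iff_le_rank d G t).1 hinj
    have h2 := hle t
    omega

/-- **THE DICHOTOMY**: a polynomial ray of linear maps is either injective at all but finitely many parameters, or injective at none.
(Over a finite field both may hold vacuously; over an infinite field exactly one does.) -/
theorem eventually_cofinite_injective_or_forall_not (d : ℕ) (G : ℕ → (V →ₗ[K] W)) :
    (∀ᶠ t in Filter.cofinite, Function.Injective (polyFamily d G t)) ∨
      ∀ t, ¬ Function.Injective (polyFamily d G t) := by
  by_cases h : ∃ t₀, Function.Injective (polyFamily d G t₀)
  · obtain ⟨t₀, h₀⟩ := h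
    exact Or.inl (Filter.eventually_cofinite.2 (setOf_not_injective_finite d G h₀))
  · exact Or.inr (fun t ht => h ⟨t, ht⟩)

omit [FiniteDimensional K V] [FiniteDimensional K W] in
/-- over an INFINITE field the two branches exclude each other: cofinitely injective ⟹ injective somewhere. -/
theorem exists_injective_of_eventually_cofinite [Infinite K] (d : ℕ) (G : ℕ → (V →ₗ[K] W))
    (h : ∀ᶠ t in Filter.cofinite, Function.Injective (polyFamily d G t)) :
    ∃ t, Function.Injective (polyFamily d G t) := by
  have hfin := Filter.eventually_cofinite.1 h
  obtain ⟨t, ht⟩ := hfin.infinite_compl.nonempty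
  exact ⟨t, by simpa using ht⟩

/-- the kernel dimension of `Π_t` is the corank of the specialised coordinate matrix. -/
theorem finrank_ker_polyFamily_eq (d : ℕ) (G : ℕ → (V →ₗ[K] W)) (t : K) :
    Module.finrank K (LinearMap.ker (polyFamily d G t)) =
      Module.finrank K V - ((polyMatrix d G).map (eval t)).rank := by
  rw [polyMatrix_map_eval, rank_toMatrix_eq_finrank_range]
  have := (polyFamily d G t).finrank_range_add_finrank_ker
  omega

/-- **THE GENERIC KERNEL DIMENSION IS THE MINIMUM, ATTAINED COFINITELY**: if `dim ker Π_{t₀} ≤ ℓ` at ONE parameter then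
`dim ker Π_t ≤ ℓ` at all but finitely many `t` (under v21's law `ker Π_t` is the failure of Bloch-semiregularity of `Z(s_t)`; a checker
reporting `dim ker Π_t` at one twist reports an UPPER bound for the generic defect). [cites `…setOf_lt_corank_map_eval_finite`] -/
theorem setOf_lt_finrank_ker_finite (d : ℕ) (G : ℕ → (V →ₗ[K] W)) {ℓ : ℕ} {t₀ : K}
    (h₀ : Module.finrank K (LinearMap.ker (polyFamily d G t₀)) ≤ ℓ) :
    {t : K | ℓ < Module.finrank K (LinearMap.ker (polyFamily d G t))}.Finite := by
  have h₀' : Fintype.card (Fin (Module.finrank K V)) - ((polyMatrix d G).map (eval t₀)).rank ≤ ℓ := by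
    rw [Fintype.card_fin, ← finrank_ker_polyFamily_eq]; exact h₀
  refine (Literature.LinearAlgebra.Matrix.setOf_lt_corank_map_eval_finite (polyMatrix d G) h₀').subset ?_
  intro t ht
  simp only [Set.mem_setOf_eq] at ht ⊢
  rw [Fintype.card_fin, ← finrank_ker_polyFamily_eq]
  exact ht

theorem rayGenericallyInjective_iff_eventually_cofinite [Infinite K] (d : ℕ) (G : ℕ → (V →ₗ[K] W)) :
    RayGenericallyInjective d G ↔ ∀ᶠ t in Filter.cofinite, Function.Injective (polyFamily d G t) := by
  constructor
  · rintro ⟨t₀, h₀⟩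
    exact Filter.eventually_cofinite.2 (setOf_not_injective_finite d G h₀)
  · exact exists_injective_of_eventually_cofinite d G

/-- the FINITE-EVALUATION form: generically injective ⟺ among ANY `d · dim V + 1` (or more) distinct parameters one is injective. -/
theorem rayGenericallyInjective_iff_forall_finset [Infinite K] (d : ℕ) (G : ℕ → (V →ₗ[K] W)) :
    RayGenericallyInjective d G ↔
      ∀ T : Finset K, Module.finrank K V * d < T.card → ∃ t ∈ T, Function.Injective (polyFamily d G t) := by
  constructor
  · rintro ⟨t₀, h₀⟩ T hT
    by_contra hnone
    push Not at hnone
    exact not_injective_of_card_lt d G T hT hnone t₀ h₀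
  · intro h
    obtain ⟨T, hT⟩ := Infinite.exists_subset_card_eq K (Module.finrank K V * d + 1)
    obtain ⟨t, -, ht⟩ := h T (by omega)
    exact ⟨t, ht⟩

end Coordinates

/-! ### §22.2 The Bloch pencil as a cubic ray: coefficients, the trace at infinity, the `9408` bound -/

/-- **the four COEFFICIENTS of the Bloch pencil** `Π_t = f₃ + v₁(t)f₂ + v₂(t)f₁ + v₃(t)f₀` as a cubic in `t`:
`G₀ = f₃ + γ₁f₂ + γ₂f₁ + γ₃f₀` (the UNTWISTED pencil, `D_ξ c₄(𝓔)` polarised), `G₁ = f₂ + γ₁f₁ + γ₂f₀`, `G₂ = f₁ + γ₁f₀`,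
`G₃ = f₀` (`= h³ ∪ Tr`: the ray's point at `t = ∞` is the TRACE). A DEFINITION. [cite: BuchweitzFlenner2003, Prop. 8.2] -/
def blochCoeff (f : Fin 4 → (V →ₗ[K] W)) (γ₁ γ₂ γ₃ : K) : ℕ → (V →ₗ[K] W)
  | 0 => f 3 + γ₁ • f 2 + γ₂ • f 1 + γ₃ • f 0
  | 1 => f 2 + γ₁ • f 1 + γ₂ • f 0
  | 2 => f 1 + γ₁ • f 0
  | 3 => f 0
  | _ => 0

@[simp] theorem blochCoeff_zero (f : Fin 4 → (V →ₗ[K] W)) (γ₁ γ₂ γ₃ : K) :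
    blochCoeff f γ₁ γ₂ γ₃ 0 = f 3 + γ₁ • f 2 + γ₂ • f 1 + γ₃ • f 0 := rfl
@[simp] theorem blochCoeff_one (f : Fin 4 → (V →ₗ[K] W)) (γ₁ γ₂ γ₃ : K) :
    blochCoeff f γ₁ γ₂ γ₃ 1 = f 2 + γ₁ • f 1 + γ₂ • f 0 := rfl
@[simp] theorem blochCoeff_two (f : Fin 4 → (V →ₗ[K] W)) (γ₁ γ₂ γ₃ : K) :
    blochCoeff f γ₁ γ₂ γ₃ 2 = f 1 + γ₁ • f 0 := rfl
@[simp] theorem blochCoeff_three (f : Fin 4 → (V →ₗ[K] W)) (γ₁ γ₂ γ₃ : K) :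
    blochCoeff f γ₁ γ₂ γ₃ 3 = f 0 := rfl

/-- **the Bloch pencil IS the cubic ray of `blochCoeff`**: `polyFamily 3 (blochCoeff f γ) t = f₃ + (γ₁+t)f₂ + (γ₂+γ₁t+t²)f₁ +
(γ₃+γ₂t+γ₁t²+t³)f₀` — literally v21's `BlochPencil.pencilₗ f γ₁ γ₂ γ₃ t` (which this file cannot import while v21 is unbuilt; the
identification is `rfl` on v21's side). -/
theorem polyFamily_blochCoeff (f : Fin 4 → (V →ₗ[K] W)) (γ₁ γ₂ γ₃ t : K) :
    polyFamily 3 (blochCoeff f γ₁ γ₂ γ₃) t =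
      f 3 + (γ₁ + t) • f 2 + (γ₂ + γ₁ * t + t ^ 2) • f 1 + (γ₃ + γ₂ * t + γ₁ * t ^ 2 + t ^ 3) • f 0 := by
  simp only [polyFamily, Finset.sum_range_succ, Finset.sum_range_zero, zero_add, pow_zero, one_smul, pow_one,
    blochCoeff_zero, blochCoeff_one, blochCoeff_two, blochCoeff_three]
  module

/-- the Bloch ray applied to a vector. -/
theorem polyFamily_blochCoeff_apply (f : Fin 4 → (V →ₗ[K] W)) (γ₁ γ₂ γ₃ t : K) (x : V) :
    polyFamily 3 (blochCoeff f γ₁ γ₂ γ₃) t x =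
      f 3 x + (γ₁ + t) • f 2 x + (γ₂ + γ₁ * t + t ^ 2) • f 1 x + (γ₃ + γ₂ * t + γ₁ * t ^ 2 + t ^ 3) • f 0 x := by
  rw [polyFamily_blochCoeff]
  simp [LinearMap.add_apply, LinearMap.smul_apply]

/-- the UNTWISTED point of the ray is `G₀ = f₃ + γ₁f₂ + γ₂f₁ + γ₃f₀`. -/
theorem polyFamily_blochCoeff_zero (f : Fin 4 → (V →ₗ[K] W)) (γ₁ γ₂ γ₃ : K) :
    polyFamily 3 (blochCoeff f γ₁ γ₂ γ₃) 0 = f 3 + γ₁ • f 2 + γ₂ • f 1 + γ₃ • f 0 := by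
  rw [polyFamily_blochCoeff]; simp

section BlochBudget

variable [FiniteDimensional K V] [FiniteDimensional K W]

/-- **ONE TWIST DECIDES the Bloch ray**: injective at one twist `t₀` (ANY `t₀ : K`) ⟹ injective at all but `≤ 3 · dim V` twists. -/
theorem blochRay_ncard_exceptional_le (f : Fin 4 → (V →ₗ[K] W)) (γ₁ γ₂ γ₃ : K) {t₀ : K}
    (h₀ : Function.Injective (polyFamily 3 (blochCoeff f γ₁ γ₂ γ₃) t₀)) :
    {t : K | ¬ Function.Injective (polyFamily 3 (blochCoeff f γ₁ γ₂ γ₃) t)}.Finite ∧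
      {t : K | ¬ Function.Injective (polyFamily 3 (blochCoeff f γ₁ γ₂ γ₃) t)}.ncard ≤ Module.finrank K V * 3 :=
  ⟨setOf_not_injective_finite 3 _ h₀, ncard_setOf_not_injective_le 3 _ h₀⟩

/-- **DEATH BY `3 · dim V + 1` FAILED TWISTS**: non-injective at more than `3 · dim V` twists ⟹ non-injective at every twist. -/
theorem blochRay_dead_of_failures (f : Fin 4 → (V →ₗ[K] W)) (γ₁ γ₂ γ₃ : K) (T : Finset K)
    (hcard : Module.finrank K V * 3 < T.card)
    (hT : ∀ t ∈ T, ¬ Function.Injective (polyFamily 3 (blochCoeff f γ₁ γ₂ γ₃) t)) (t : K) :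
    ¬ Function.Injective (polyFamily 3 (blochCoeff f γ₁ γ₂ γ₃) t) :=
  not_injective_of_card_lt 3 _ T hcard hT t

/-- with the lci-door budget `dim V = ext²(𝓔,𝓔) ≤ h^{3,5}(S⁴) = 3136` (v21 §21.1; else dead at every twist by count), the exceptional set of an
injective Bloch ray has at most `9408` twists, and `9409` failed twists certify death. [arithmetic] -/
theorem blochRay_ncard_exceptional_le_of_budget (f : Fin 4 → (V →ₗ[K] W)) (γ₁ γ₂ γ₃ : K) {t₀ : K}
    (hbudget : Module.finrank K V ≤ 3136)
    (h₀ : Function.Injective (polyFamily 3 (blochCoeff f γ₁ γ₂ γ₃) t₀)) :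
    {t : K | ¬ Function.Injective (polyFamily 3 (blochCoeff f γ₁ γ₂ γ₃) t)}.ncard ≤ 9408 :=
  (blochRay_ncard_exceptional_le f γ₁ γ₂ γ₃ h₀).2.trans (by omega)

theorem blochRay_dead_of_failures_of_budget (f : Fin 4 → (V →ₗ[K] W)) (γ₁ γ₂ γ₃ : K) (T : Finset K)
    (hbudget : Module.finrank K V ≤ 3136) (hcard : 9408 < T.card)
    (hT : ∀ t ∈ T, ¬ Function.Injective (polyFamily 3 (blochCoeff f γ₁ γ₂ γ₃) t)) (t : K) :
    ¬ Function.Injective (polyFamily 3 (blochCoeff f γ₁ γ₂ γ₃) t) :=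
  blochRay_dead_of_failures f γ₁ γ₂ γ₃ T (by omega) hT t

/-- `3 · h^{3,5}(abelian 8-fold) = 3 · C(8,3)·C(8,5) = 9408`. [`decide`] -/
theorem nine_thousand_four_hundred_eight : 3 * (Nat.choose 8 3 * Nat.choose 8 5) = 9408 := by decide

end BlochBudget

/-- **C7 AT THE LCI DOOR, `t`-FREE** — the seed checker's clause on (design, presentation): the Bloch ray of the four cupped sigmas
`f` with the design's Chern numbers `γ₁, γ₂, γ₃` is generically injective. Under v21's law this is «`Z(s_t)` is Bloch-semiregular for all
but finitely many twists `t` of the Koszul window, for every regular section `s_t`» (`lciDoorGeneric_iff_exists_good`,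
`lciDoorGeneric_iff_cofinite_good` below). A DEFINITION. -/
def LciDoorGeneric (f : Fin 4 → (V →ₗ[K] W)) (γ₁ γ₂ γ₃ : K) : Prop :=
  RayGenericallyInjective 3 (blochCoeff f γ₁ γ₂ γ₃)

theorem lciDoorGeneric_iff (f : Fin 4 → (V →ₗ[K] W)) (γ₁ γ₂ γ₃ : K) :
    LciDoorGeneric f γ₁ γ₂ γ₃ ↔ ∃ t : K, Function.Injective (polyFamily 3 (blochCoeff f γ₁ γ₂ γ₃) t) :=
  Iff.rfl

/-- the UNTWISTED certificate: `G₀ = f₃ + γ₁f₂ + γ₂f₁ + γ₃f₀` (the design's own polarised `D_ξ c₄`) injective ⟹ the lci door is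
generically open. -/
theorem lciDoorGeneric_of_untwisted_injective (f : Fin 4 → (V →ₗ[K] W)) (γ₁ γ₂ γ₃ : K)
    (h : Function.Injective (f 3 + γ₁ • f 2 + γ₂ • f 1 + γ₃ • f 0)) : LciDoorGeneric f γ₁ γ₂ γ₃ :=
  ⟨0, by rwa [polyFamily_blochCoeff_zero]⟩

/-- necessity of the budget for the `t`-free clause: `dim W < dim V` ⟹ the lci door is generically (indeed always) shut. -/
theorem not_lciDoorGeneric_of_finrank_lt [FiniteDimensional K W] (f : Fin 4 → (V →ₗ[K] W)) (γ₁ γ₂ γ₃ : K)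
    (hlt : Module.finrank K W < Module.finrank K V) : ¬ LciDoorGeneric f γ₁ γ₂ γ₃ := by
  rintro ⟨t, ht⟩
  exact lt_irrefl _ (hlt.trans_le (LinearMap.finrank_le_finrank_of_injective ht))

/-! ### §22.3 Checker-shaped consequences under the C7 ↔ injectivity dictionary -/

section Checker

variable [FiniteDimensional K V] [FiniteDimensional K W]

/-- **CERTIFICATE AT ANY TWIST.** Let `C7At t` be «C7 at the lci door for the twisted design `D(t)` with its presentation» and suppose the
dictionary `C7At t ↔ Injective Π_t` on a window `S ⊆ K` (v21: `BlochAdjugateLaw` + `blochAdjugate_eq_pencil_of_realisedBy`, `S` = the Koszul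
window). Then injectivity of the ray at ANY ONE parameter `t₁ : K` — inside the window OR NOT (e.g. the untwisted `t₁ = 0`, the design's own
polarised `D_ξ c₄`) — gives C7 at all but finitely many (`≤ d · dim V`) twists of the window. -/
theorem cofinite_good_of_injective_once (d : ℕ) (G : ℕ → (V →ₗ[K] W)) {C7At : K → Prop} {S : Set K}
    (hdict : ∀ t ∈ S, (C7At t ↔ Function.Injective (polyFamily d G t))) {t₁ : K}
    (h₁ : Function.Injective (polyFamily d G t₁)) :
    {t : K | t ∈ S ∧ ¬ C7At t}.Finite ∧ {t : K | t ∈ S ∧ ¬ C7At t}.ncard ≤ Module.finrank K V * d := by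
  have hsub : {t : K | t ∈ S ∧ ¬ C7At t} ⊆ {t : K | ¬ Function.Injective (polyFamily d G t)} := by
    rintro t ⟨htS, hbad⟩ hinj
    exact hbad ((hdict t htS).2 hinj)
  have hfin := setOf_not_injective_finite d G h₁
  exact ⟨hfin.subset hsub, (Set.ncard_le_ncard hsub hfin).trans (ncard_setOf_not_injective_le d G h₁)⟩

/-- **DEATH CERTIFICATE for the checker.** Non-injectivity of the ray at more than `d · dim V` parameters (anywhere in `K`) ⟹ C7 fails at
EVERY twist of the window. -/
theorem forall_not_good_of_failures (d : ℕ) (G : ℕ → (V →ₗ[K] W)) {C7At : K → Prop} {S : Set K}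
    (hdict : ∀ t ∈ S, (C7At t ↔ Function.Injective (polyFamily d G t))) (T : Finset K)
    (hcard : Module.finrank K V * d < T.card) (hT : ∀ t ∈ T, ¬ Function.Injective (polyFamily d G t)) :
    ∀ t ∈ S, ¬ C7At t :=
  fun t htS hgood => not_injective_of_card_lt d G T hcard hT t ((hdict t htS).1 hgood)

omit [FiniteDimensional K V] [FiniteDimensional K W] in
/-- conversely ONE failure inside the window at a parameter where the ray IS injective is impossible — so a window twist where C7 fails is a
genuine exceptional parameter of the ray (useful for auditing a claimed failure). -/
theorem not_injective_of_not_good (d : ℕ) (G : ℕ → (V →ₗ[K] W)) {C7At : K → Prop} {S : Set K}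
    (hdict : ∀ t ∈ S, (C7At t ↔ Function.Injective (polyFamily d G t))) {t : K} (htS : t ∈ S) (hbad : ¬ C7At t) :
    ¬ Function.Injective (polyFamily d G t) :=
  fun hinj => hbad ((hdict t htS).2 hinj)

/-- **THE `t`-FREE CLAUSE IS EXACTLY «C7 SOMEWHERE IN THE WINDOW» IS EXACTLY «C7 COFINITELY IN THE WINDOW»** (infinite window):
generic injectivity of the ray ⟺ C7 holds at SOME twist of the window. -/
theorem rayGenericallyInjective_iff_exists_good (d : ℕ) (G : ℕ → (V →ₗ[K] W)) {C7At : K → Prop} {S : Set K}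
    (hS : S.Infinite) (hdict : ∀ t ∈ S, (C7At t ↔ Function.Injective (polyFamily d G t))) :
    RayGenericallyInjective d G ↔ ∃ t ∈ S, C7At t := by
  constructor
  · rintro ⟨t₁, h₁⟩
    have hfin := (cofinite_good_of_injective_once d G hdict h₁).1
    obtain ⟨t, htS, ht⟩ := (hS.sdiff hfin).nonempty
    refine ⟨t, htS, ?_⟩
    by_contra hbad
    exact ht ⟨htS, hbad⟩
  · rintro ⟨t, htS, hgood⟩
    exact ⟨t, (hdict t htS).1 hgood⟩

/-- … ⟺ C7 fails at only FINITELY many twists of the window. -/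
theorem rayGenericallyInjective_iff_cofinite_good (d : ℕ) (G : ℕ → (V →ₗ[K] W)) {C7At : K → Prop} {S : Set K}
    (hS : S.Infinite) (hdict : ∀ t ∈ S, (C7At t ↔ Function.Injective (polyFamily d G t))) :
    RayGenericallyInjective d G ↔ {t : K | t ∈ S ∧ ¬ C7At t}.Finite := by
  constructor
  · rintro ⟨t₁, h₁⟩
    exact (cofinite_good_of_injective_once d G hdict h₁).1
  · intro hfin
    obtain ⟨t, htS, ht⟩ := (hS.sdiff hfin).nonempty
    have hgood : C7At t := by
      by_contra hbad
      exact ht ⟨htS, hbad⟩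
    exact ⟨t, (hdict t htS).1 hgood⟩

/-- Bloch specialisation: with an infinite window, `LciDoorGeneric f γ` ⟺ C7 at some window twist ⟺ C7 at all but `≤ 3 · dim V`
window twists. -/
theorem lciDoorGeneric_iff_exists_good (f : Fin 4 → (V →ₗ[K] W)) (γ₁ γ₂ γ₃ : K) {C7At : K → Prop} {S : Set K}
    (hS : S.Infinite) (hdict : ∀ t ∈ S, (C7At t ↔ Function.Injective (polyFamily 3 (blochCoeff f γ₁ γ₂ γ₃) t))) :
    LciDoorGeneric f γ₁ γ₂ γ₃ ↔ ∃ t ∈ S, C7At t :=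
  rayGenericallyInjective_iff_exists_good 3 _ hS hdict

theorem lciDoorGeneric_iff_cofinite_good (f : Fin 4 → (V →ₗ[K] W)) (γ₁ γ₂ γ₃ : K) {C7At : K → Prop} {S : Set K}
    (hS : S.Infinite) (hdict : ∀ t ∈ S, (C7At t ↔ Function.Injective (polyFamily 3 (blochCoeff f γ₁ γ₂ γ₃) t))) :
    LciDoorGeneric f γ₁ γ₂ γ₃ ↔ {t : K | t ∈ S ∧ ¬ C7At t}.Finite :=
  rayGenericallyInjective_iff_cofinite_good 3 _ hS hdict

theorem ncard_bad_le_of_lciDoorGeneric (f : Fin 4 → (V →ₗ[K] W)) (γ₁ γ₂ γ₃ : K) {C7At : K → Prop} {S : Set K}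
    (hdict : ∀ t ∈ S, (C7At t ↔ Function.Injective (polyFamily 3 (blochCoeff f γ₁ γ₂ γ₃) t)))
    (h : LciDoorGeneric f γ₁ γ₂ γ₃) : {t : K | t ∈ S ∧ ¬ C7At t}.ncard ≤ Module.finrank K V * 3 := by
  obtain ⟨t₁, h₁⟩ := h
  exact (cofinite_good_of_injective_once 3 _ hdict h₁).2

/-- **INTEGER TWISTS, EVENTUAL FORM** (the shape of v17's `EventuallySemiregularZeroLoci`): for a field of characteristic `0`, a predicate
`C7At : ℤ → Prop` on integer twists agreeing with injectivity of `Π_{(t : K)}` for `t ≥ t₀`, and ONE parameter `t₁ : K` where the ray is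
injective, C7 holds for all sufficiently large integer twists. -/
theorem eventually_atTop_good_of_injective_once [CharZero K] (d : ℕ) (G : ℕ → (V →ₗ[K] W)) {C7At : ℤ → Prop}
    {t₀ : ℤ} (hdict : ∀ t : ℤ, t₀ ≤ t → (C7At t ↔ Function.Injective (polyFamily d G (t : K)))) {t₁ : K}
    (h₁ : Function.Injective (polyFamily d G t₁)) :
    ∀ᶠ t in Filter.atTop, C7At t := by
  have hfin := setOf_not_injective_finite d G h₁
  have hfinZ : {t : ℤ | ¬ Function.Injective (polyFamily d G (t : K))}.Finite :=
    (hfin.preimage (Int.cast_injective.injOn)).subset (fun t ht => ht)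
  obtain ⟨B, hB⟩ := hfinZ.bddAbove
  refine Filter.eventually_atTop.2 ⟨max t₀ (B + 1), fun t ht => ?_⟩
  have ht₀ : t₀ ≤ t := le_trans (le_max_left _ _) ht
  have htB : B < t := lt_of_lt_of_le (lt_of_lt_of_le (lt_add_one B) (le_max_right _ _)) ht
  refine (hdict t ht₀).2 ?_
  by_contra hbad
  exact (not_le.2 htB) (hB hbad)

/-- the same with the exceptional integer twists COUNTED: at most `d · dim V` integers `t ≥ t₀` fail. -/
theorem ncard_bad_integer_twists_le [CharZero K] (d : ℕ) (G : ℕ → (V →ₗ[K] W)) {C7At : ℤ → Prop}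
    {t₀ : ℤ} (hdict : ∀ t : ℤ, t₀ ≤ t → (C7At t ↔ Function.Injective (polyFamily d G (t : K)))) {t₁ : K}
    (h₁ : Function.Injective (polyFamily d G t₁)) :
    {t : ℤ | t₀ ≤ t ∧ ¬ C7At t}.Finite ∧ {t : ℤ | t₀ ≤ t ∧ ¬ C7At t}.ncard ≤ Module.finrank K V * d := by
  have hfin := setOf_not_injective_finite d G h₁
  have himg : (fun t : ℤ => (t : K)) '' {t : ℤ | t₀ ≤ t ∧ ¬ C7At t} ⊆
      {t : K | ¬ Function.Injective (polyFamily d G t)} := by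
    rintro _ ⟨t, ⟨ht₀, hbad⟩, rfl⟩ hinj
    exact hbad ((hdict t ht₀).2 hinj)
  have hfinZ : {t : ℤ | t₀ ≤ t ∧ ¬ C7At t}.Finite :=
    Set.Finite.of_finite_image (hfin.subset himg) Int.cast_injective.injOn
  refine ⟨hfinZ, ?_⟩
  calc {t : ℤ | t₀ ≤ t ∧ ¬ C7At t}.ncard
      = ((fun t : ℤ => (t : K)) '' {t : ℤ | t₀ ≤ t ∧ ¬ C7At t}).ncard :=
        (Set.ncard_image_of_injective _ Int.cast_injective).symm
    _ ≤ {t : K | ¬ Function.Injective (polyFamily d G t)}.ncard := Set.ncard_le_ncard himg hfin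
    _ ≤ Module.finrank K V * d := ncard_setOf_not_injective_le d G h₁

end Checker

/-! ### §22.4 Flags as theorems: lci-C7 is not implied by the sheaf screen, and not vacuous -/

section Flags

/-- **NOT IMPLIED BY THE SHEAF DOOR'S SCREEN.** v21 proved lci-C7 ⟹ `f₀, …, f₃` jointly injective (the sheaf door's window
semiregularity). The converse FAILS already in dimension two: on `V = ℚ²`, `W = ℚ` take `f₀ = f₁ = 0`, `f₂ =` first coordinate,
`f₃ =` second coordinate — jointly injective, yet the Bloch ray `V → W` is injective at NO twist, for NO Chern data (`dim W < dim V`).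
So the lci-door clause C7 is a genuinely new predicate on (design, presentation), not a rewording of the sheaf screen. -/
theorem jointly_injective_not_suffices :
    ∃ f : Fin 4 → ((Fin 2 → ℚ) →ₗ[ℚ] ℚ),
      (∀ x : Fin 2 → ℚ, (∀ j, f j x = 0) → x = 0) ∧
        ∀ γ₁ γ₂ γ₃ t : ℚ, ¬ Function.Injective (polyFamily 3 (blochCoeff f γ₁ γ₂ γ₃) t) := by
  refine ⟨![0, 0, LinearMap.proj 0, LinearMap.proj 1], ?_, ?_⟩
  · intro x hx
    have h2 := hx 2
    have h3 := hx 3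
    simp only [Matrix.cons_val] at h2 h3
    ext i
    fin_cases i
    · simpa using h2
    · simpa using h3
  · intro γ₁ γ₂ γ₃ t hinj
    have hle := LinearMap.finrank_le_finrank_of_injective hinj
    rw [Module.finrank_fin_fun, Module.finrank_self] at hle
    omega

/-- **NOT VACUOUS (passes somewhere).** On `V = W = ℚ` with `f₀ = f₁ = f₂ = 0`, `f₃ = id`, the Bloch ray is the identity at every twist:
generically injective. -/
theorem rayGenericallyInjective_example :
    RayGenericallyInjective (K := ℚ) 3 (blochCoeff (![0, 0, 0, LinearMap.id] : Fin 4 → (ℚ →ₗ[ℚ] ℚ)) 0 0 0) := by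
  refine ⟨0, ?_⟩
  rw [polyFamily_blochCoeff_zero]
  intro x y hxy
  simpa using hxy

/-- **NOT VACUOUS (fails somewhere).** On `V = W = ℚ` with all `f_j = 0` the ray is `0` at every twist: not generically injective. -/
theorem not_rayGenericallyInjective_example :
    ¬ RayGenericallyInjective (K := ℚ) 3 (blochCoeff (![0, 0, 0, 0] : Fin 4 → (ℚ →ₗ[ℚ] ℚ)) 0 0 0) := by
  rintro ⟨t, ht⟩
  have h := ht (a₁ := 1) (a₂ := 0) (by simp [polyFamily_blochCoeff_apply])
  exact one_ne_zero h

end Flags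

end TwistRay

end VTwentyTwo

end Summit.HodgeConjecture.HodgeConjecture.Cruxes.BlochSeedDiscOne.SeedChecker
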